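import Summits.CriticalPhenomena.PercolationContinuityZ3.Theorems.PercNearOneGluingNoHeavyPcintBSMMoments
import Literature.Probability.Percolation.SitePercolationMeasure
import Literature.Probability.Percolation.SiteMonotonicity
import Literature.Probability.Percolation.SiteConnectionTools
import HarnessLib

/-!
# PCINT lane, PHASE 8 (block renewal, SITE version), step 1: vertex keys of block words and the open site path

Cell `prim-pcint`, seat `prim-pcint-1` (gen 16); memo `run/shared/lean/prim/pcint/T-FIBRE-ROUTE.md` §PHASE 8.

The SITE analogue of …PcintBSMBridge.  A block of a semi-oriented block path (a transverse piece followed by one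
time step, …PcintBSMBlocks) is given the vertex set **`BSMX.Vst`** = its START vertex together with the vertices
entered by its transverse steps (local keys `(0, u)`: all at the block's own time level; the vertex after the time step
is the next block's start).  The local shared-vertex count at pair offset `o` is
**`BSMX.RlocV pc o b b' = 𝟙[o.1 = 0] · |Vst b ∩ (o.2 + Vst b')|`** (NOT the tree's `BSM.RlocS`, whose blocks carry the
time-step vertex instead of the start and would miss next-starts reached along different time axes).  Globally
(`BSMX.VjS`, `BSMX.VglobS`, keys `(time position, transverse position) : BSM.Off t k`, sites via `BSM.ι`) the vertex
sets of block `j` of any two words live at time level `j`, so **`BSMX.card_inter_VglobS`**: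
`|VglobS β ∩ VglobS β'| = Ksh RlocV pc 0 β β'`, exactly as `BSM.card_inter_Eglob` for edges.  Finally, if every
vertex of `VglobS β` is open (a word of `m + 2` blocks), the open-site graph joins the origin to the start of block
`m + 1`, which lies outside the graph ball `B(0, m)`; hence the configuration is in the site exit event of `B(0, m)`
(**`BSMX.exitEvent_of_openV`**).
-/

noncomputable section

namespace Summit.CriticalPhenomena.PercolationContinuityZ3.Theorems.Pcint.BSMX

open Finset OSM BSM Literature.Probability.Percolation Literature.Probability.LatticeModels

variable {t k np : ℕ}

/-! ### Local vertex keys and the local shared-vertex count -/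

/-- **The vertex keys of a block**: its start `(0, 0)` and the vertices entered by its transverse steps. -/
def Vst (pc : Fin np → List (Fin t × Bool)) (b : Blk np k) : Finset (VKey t k) :=
  insert (0, 0) (tverts k 0 (pc b.1))

/-- **Shared vertices of the first blocks** at pair offset `o` (site reward): none unless the time offset vanishes,
then the common vertex keys of `b` and of `b'` shifted by the transverse offset. -/
def RlocV (pc : Fin np → List (Fin t × Bool)) (o : Off t k) (b b' : Blk np k) : ℕ :=
  if o.1 = 0 then (Vst pc b ∩ (Vst pc b').map (shiftV o.2)).card else 0

/-- Vertex keys entered by transverse steps have time displacement `0`. -/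
theorem fst_eq_zero_of_mem_tverts : ∀ (σ : List (Fin t × Bool)) (u : Fin t → ℤ) {q : VKey t k},
    q ∈ tverts k u σ → q.1 = 0
  | [], u, q, h => by simp [tverts] at h
  | s :: σ, u, q, h => by
    rw [tverts, mem_insert] at h
    rcases h with rfl | h
    · rfl
    · exact fst_eq_zero_of_mem_tverts σ (u + sv s) h

/-- All vertex keys of a block have time displacement `0`. -/
theorem fst_eq_zero_of_mem_Vst (pc : Fin np → List (Fin t × Bool)) (b : Blk np k) {q : VKey t k}
    (hq : q ∈ Vst pc b) : q.1 = 0 := by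
  rw [Vst, mem_insert] at hq
  rcases hq with rfl | hq
  · rfl
  · exact fst_eq_zero_of_mem_tverts _ 0 hq

/-- The reward vanishes off the diagonal time class. -/
theorem fst_eq_zero_of_RlocV_ne_zero (pc : Fin np → List (Fin t × Bool)) {o : Off t k} {b b' : Blk np k}
    (h : RlocV pc o b b' ≠ 0) : o.1 = 0 := by
  by_contra h1; exact h (by rw [RlocV, if_neg h1])

/-- A nonzero reward exhibits a common vertex key. -/
theorem exists_of_RlocV_ne_zero (pc : Fin np → List (Fin t × Bool)) {o : Off t k} {b b' : Blk np k}
    (h : RlocV pc o b b' ≠ 0) : ∃ q ∈ Vst pc b, ∃ q' ∈ Vst pc b', o.2 = q.2 - q'.2 := by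
  rw [RlocV, if_pos (fst_eq_zero_of_RlocV_ne_zero pc h)] at h
  obtain ⟨q, hq⟩ := Finset.card_pos.1 (Nat.pos_of_ne_zero h)
  rw [mem_inter, mem_map] at hq
  obtain ⟨hq1, q', hq', hqq⟩ := hq
  refine ⟨q, hq1, q', hq', ?_⟩
  rw [← hqq]; simp [shiftV]

/-! ### Global vertex keys of a block word -/

/-- The global key of a local vertex key of a block started at `(T, X)`: `(T, X + u)`. -/
def embedV (T : Fin k → ℤ) (X : Fin t → ℤ) : VKey t k ↪ Off t k :=
  ⟨fun q => (T + q.1, q.2 + X), fun q q' h => by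
    simp only [Prod.mk.injEq, add_right_inj, add_left_inj] at h; exact Prod.ext h.1 h.2⟩

/-- The global vertex keys of block `j` of the word `β`. -/
def VjS (pc : Fin np → List (Fin t × Bool)) {n : ℕ} (β : Fin n → Blk np k) (j : Fin n) : Finset (Off t k) :=
  (Vst pc (β j)).map (embedV (posB pc β j).1 (posB pc β j).2)

/-- **The global vertex keys of a block word** (all blocks; the final endpoint is not included). -/
def VglobS (pc : Fin np → List (Fin t × Bool)) {n : ℕ} (β : Fin n → Blk np k) : Finset (Off t k) :=
  univ.biUnion (VjS pc β)

/-- Keys of block `j` carry the time position of block `j` … -/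
theorem fst_of_mem_VjS {pc : Fin np → List (Fin t × Bool)} {n : ℕ} {β : Fin n → Blk np k} {j : Fin n} {g : Off t k}
    (h : g ∈ VjS pc β j) : g.1 = (posB pc β j).1 := by
  obtain ⟨q, hq, rfl⟩ := mem_map.1 h
  simp [embedV, fst_eq_zero_of_mem_Vst pc (β j) hq]

/-- … whose coordinates sum to `j`. -/
theorem sum_fst_of_mem_VjS {pc : Fin np → List (Fin t × Bool)} {n : ℕ} {β : Fin n → Blk np k} {j : Fin n}
    {g : Off t k} (h : g ∈ VjS pc β j) : ∑ a, g.1 a = (j : ℕ) := by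
  rw [fst_of_mem_VjS h, sum_posB_fst pc β (le_of_lt j.2)]

/-- Vertex keys of different blocks (of any two words) are disjoint. -/
theorem disjoint_VjS (pc : Fin np → List (Fin t × Bool)) {n : ℕ} (β β' : Fin n → Blk np k) {j j' : Fin n}
    (hjj : j ≠ j') : Disjoint (VjS pc β j) (VjS pc β' j') := by
  rw [Finset.disjoint_left]
  intro g h h'
  have h1 := sum_fst_of_mem_VjS h
  have h2 := sum_fst_of_mem_VjS h'
  rw [h1] at h2
  exact hjj (Fin.ext (by exact_mod_cast h2))

/-- The start of block `j` is one of its vertices. -/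
theorem posB_mem_VjS (pc : Fin np → List (Fin t × Bool)) {n : ℕ} (β : Fin n → Blk np k) (j : Fin n) :
    posB pc β j ∈ VjS pc β j :=
  mem_map.2 ⟨(0, 0), by rw [Vst]; exact mem_insert_self _ _, by simp [embedV]⟩

/-- **Shared vertices of block `j`**: `|VjS β j ∩ VjS β' j| = RlocV (offAt 0 β β' j) (β j) (β' j)`. -/
theorem card_VjS_inter (pc : Fin np → List (Fin t × Bool)) {n : ℕ} (β β' : Fin n → Blk np k) (j : Fin n) :
    (VjS pc β j ∩ VjS pc β' j).card = RlocV pc (offAt pc 0 β β' j) (β j) (β' j) := by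
  rw [RlocV, offAt_zero_eq, Prod.fst_sub, Prod.snd_sub]
  by_cases hT : (posB pc β' j).1 - (posB pc β j).1 = 0
  · rw [if_pos hT]
    have hTT : (posB pc β' j).1 = (posB pc β j).1 := sub_eq_zero.1 hT
    have hset : VjS pc β j ∩ VjS pc β' j =
        (Vst pc (β j) ∩ (Vst pc (β' j)).map (shiftV ((posB pc β' j).2 - (posB pc β j).2))).map
          (embedV (posB pc β j).1 (posB pc β j).2) := by
      ext g
      simp only [VjS, mem_inter, mem_map, embedV, shiftV, Function.Embedding.coeFn_mk]
      constructor
      · rintro ⟨⟨q, hq, rfl⟩, ⟨q', hq', hqq'⟩⟩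
        simp only [Prod.mk.injEq] at hqq'
        obtain ⟨h1, h2⟩ := hqq'
        have hq0 := fst_eq_zero_of_mem_Vst pc (β j) hq
        have hq0' := fst_eq_zero_of_mem_Vst pc (β' j) hq'
        refine ⟨q, ⟨hq, q', hq', ?_⟩, rfl⟩
        refine Prod.ext (by rw [hq0, hq0']) ?_
        dsimp only
        linear_combination h2
      · rintro ⟨q, ⟨hq, q', hq', rfl⟩, rfl⟩
        have hq0' := fst_eq_zero_of_mem_Vst pc (β' j) hq'
        refine ⟨⟨_, hq, rfl⟩, ⟨q', hq', ?_⟩⟩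
        refine Prod.ext ?_ ?_
        · dsimp only; rw [hTT]
        · dsimp only; abel
    rw [hset, card_map]
  · rw [if_neg hT, Finset.card_eq_zero, ← Finset.disjoint_iff_inter_eq_empty, Finset.disjoint_left]
    intro g h h'
    exact hT (by rw [← fst_of_mem_VjS h', ← fst_of_mem_VjS h, sub_self])

/-- Common vertex keys sit in common blocks. -/
theorem inter_VglobS (pc : Fin np → List (Fin t × Bool)) {n : ℕ} (β β' : Fin n → Blk np k) :
    VglobS pc β ∩ VglobS pc β' = univ.biUnion fun j => VjS pc β j ∩ VjS pc β' j := by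
  ext g
  simp only [VglobS, mem_inter, mem_biUnion, mem_univ, true_and]
  constructor
  · rintro ⟨⟨j, hj⟩, ⟨j', hj'⟩⟩
    have hjj : j = j' := by
      have h1 := sum_fst_of_mem_VjS hj
      have h2 := sum_fst_of_mem_VjS hj'
      rw [h1] at h2
      exact Fin.ext (by exact_mod_cast h2)
    subst hjj
    exact ⟨j, hj, hj'⟩
  · rintro ⟨j, hj, hj'⟩
    exact ⟨⟨j, hj⟩, ⟨j, hj'⟩⟩

/-- **Shared vertex keys of two block words**: `|VglobS β ∩ VglobS β'| = Ksh RlocV pc 0 β β'`. -/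
theorem card_inter_VglobS (pc : Fin np → List (Fin t × Bool)) {n : ℕ} (β β' : Fin n → Blk np k) :
    (VglobS pc β ∩ VglobS pc β').card = Ksh (RlocV pc) pc 0 β β' := by
  rw [inter_VglobS, card_biUnion]
  · exact sum_congr rfl fun j _ => card_VjS_inter pc β β' j
  · intro j _ j' _ hjj
    exact (disjoint_VjS pc β β' hjj).mono inter_subset_left inter_subset_right

/-! ### The open site path along a block word -/

/-- **Walking a piece through open sites**: if the start and all entered vertices of a piece started at `(T, X + u)`
are open, the open-site graph joins the start to the end of the piece. -/
theorem reachable_piece (ω : SiteConfig (Site (k + t))) (T : Fin k → ℤ) (X : Fin t → ℤ) :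
    ∀ (σ : List (Fin t × Bool)) (u : Fin t → ℤ), ι (T, X + u) ∈ ω →
      (∀ q ∈ tverts k u σ, ι (T, X + q.2) ∈ ω) →
      (siteOpenGraph (zdGraph (k + t)) ω).Reachable (ι (T, X + u)) (ι (T, X + u + (σ.map sv).sum))
  | [], u, _, _ => by simp
  | q :: σ, u, hu, h => by
    have hnext : ι (T, X + (u + sv q)) ∈ ω := h _ (by rw [tverts]; exact mem_insert_self _ _)
    have hadj : (siteOpenGraph (zdGraph (k + t)) ω).Adj (ι (T, X + u)) (ι (T, X + (u + sv q))) := by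
      rw [siteOpenGraph_adj]
      refine ⟨?_, hu, hnext⟩
      have hstep : ι ((T, X + (u + sv q)) : Off t k) = ι ((T, X + u) : Off t k) + ι (axisVec (Sum.inl q.1 : Fin t ⊕ Fin k)) ∨
          ι ((T, X + u) : Off t k) = ι ((T, X + (u + sv q)) : Off t k) + ι (axisVec (Sum.inl q.1 : Fin t ⊕ Fin k)) := by
        by_cases hq : q.2 = true
        · left
          have hsv : sv q = Pi.single q.1 1 := by funext i; simp [sv, hq]
          rw [← ι_add]; congr 1
          refine Prod.ext (by simp [axisVec]) ?_
          show X + (u + sv q) = X + u + (axisVec (Sum.inl q.1 : Fin t ⊕ Fin k) : Off t k).2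
          simp only [axisVec, hsv]; abel
        · right
          have hsv : sv q = -Pi.single q.1 1 := by
            funext i; simp [sv, hq, Pi.single_apply, Pi.neg_apply]; split_ifs <;> simp
          rw [← ι_add]; congr 1
          refine Prod.ext (by simp [axisVec]) ?_
          show X + u = X + (u + sv q) + (axisVec (Sum.inl q.1 : Fin t ⊕ Fin k) : Off t k).2
          simp only [axisVec, hsv]; abel
      rcases hstep with hstep | hstep
      · rw [hstep]; exact adj_gedge (T, (X + u, (Sum.inl q.1 : Fin t ⊕ Fin k)))
      · rw [hstep]; exact (adj_gedge (T, (X + (u + sv q), (Sum.inl q.1 : Fin t ⊕ Fin k)))).symm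
    have hrest := reachable_piece ω T X σ (u + sv q) hnext
      (fun q' hq' => h q' (by rw [tverts]; exact mem_insert_of_mem hq'))
    have e2 : X + (u + sv q) + (σ.map sv).sum = X + u + ((q :: σ).map sv).sum := by
      simp only [List.map_cons, List.sum_cons]; abel
    rw [e2] at hrest
    exact hadj.reachable.trans hrest

/-- **The open site path along a block word**: if all vertices of `VglobS β` are open, the open-site graph joins the
origin to the start of block `j` for every `j < n`. -/
theorem reachable_blocks (pc : Fin np → List (Fin t × Bool)) {n : ℕ} (β : Fin n → Blk np k)
    {ω : SiteConfig (Site (k + t))} (hω : ∀ g ∈ VglobS pc β, ι g ∈ ω) :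
    ∀ j, j < n → (siteOpenGraph (zdGraph (k + t)) ω).Reachable (0 : Site (k + t)) (ι (posB pc β j))
  | 0, _ => by
    have : posB pc β 0 = 0 := by simp [posB]
    rw [this, ι_zero]
  | j + 1, hj => by
    have hj' : j < n := Nat.lt_of_succ_lt hj
    have ih := reachable_blocks pc β hω j hj'
    have hV : ∀ q ∈ Vst pc (β ⟨j, hj'⟩), ι ((posB pc β j).1, (posB pc β j).2 + q.2) ∈ ω := by
      intro q hq
      have hg := hω _ (mem_biUnion.2 ⟨⟨j, hj'⟩, mem_univ _, mem_map.2 ⟨q, hq, rfl⟩⟩)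
      have hq0 := fst_eq_zero_of_mem_Vst pc (β ⟨j, hj'⟩) hq
      have e : embedV (posB pc β j).1 (posB pc β j).2 q = ((posB pc β j).1, (posB pc β j).2 + q.2) :=
        Prod.ext (by simp [embedV, hq0]) (by show q.2 + (posB pc β j).2 = (posB pc β j).2 + q.2; exact add_comm _ _)
      rw [e] at hg
      exact hg
    -- the start of block `j` is open
    have hstart : ι ((posB pc β j).1, (posB pc β j).2 + 0) ∈ ω := hV (0, 0) (by rw [Vst]; exact mem_insert_self _ _)
    have hstart' : ι (posB pc β j) ∈ ω := by simpa using hstart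
    -- along the piece
    have h1 : (siteOpenGraph (zdGraph (k + t)) ω).Reachable (ι (posB pc β j))
        (ι ((posB pc β j).1, (posB pc β j).2 + pend (pc (β ⟨j, hj'⟩).1))) := by
      have := reachable_piece ω (posB pc β j).1 (posB pc β j).2 (pc (β ⟨j, hj'⟩).1) 0 hstart
        (fun q hq => hV q (by rw [Vst]; exact mem_insert_of_mem hq))
      simpa [pend] using this
    have hendopen : ι ((posB pc β j).1, (posB pc β j).2 + pend (pc (β ⟨j, hj'⟩).1)) ∈ ω :=
      mem_of_siteOpenGraph_reachable h1 hstart'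
    -- the time step to the start of block `j+1`, which is open (a vertex of block `j+1`)
    have hend : ι ((posB pc β j).1, (posB pc β j).2 + pend (pc (β ⟨j, hj'⟩).1)) +
        ι (axisVec (Sum.inr (β ⟨j, hj'⟩).2 : Fin t ⊕ Fin k)) = ι (posB pc β (j + 1)) := by
      rw [posB_succ pc β hj', ← ι_add]
      congr 1
      refine Prod.ext ?_ ?_
      · simp [axisVec, dsp]
      · simp [axisVec, dsp]
    have hopen : ι (posB pc β (j + 1)) ∈ ω :=
      hω _ (mem_biUnion.2 ⟨⟨j + 1, hj⟩, mem_univ _, posB_mem_VjS pc β ⟨j + 1, hj⟩⟩)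
    have hadj : (siteOpenGraph (zdGraph (k + t)) ω).Adj (ι ((posB pc β j).1, (posB pc β j).2 + pend (pc (β ⟨j, hj'⟩).1)))
        (ι (posB pc β (j + 1))) := by
      rw [siteOpenGraph_adj, ← hend]
      refine ⟨adj_gedge ((posB pc β j).1, ((posB pc β j).2 + pend (pc (β ⟨j, hj'⟩).1), (Sum.inr (β ⟨j, hj'⟩).2 : Fin t ⊕ Fin k))),
        hendopen, ?_⟩
      rw [hend]; exact hopen
    exact ih.trans (h1.trans hadj.reachable)

/-! ### The exit event -/

/-- The start of block `j > m` lies outside the graph ball `B(0, m)` (its time coordinates sum to `j`). -/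
theorem posB_not_mem_ball' (pc : Fin np → List (Fin t × Bool)) {n m j : ℕ} (β : Fin n → Blk np k) (hjn : j ≤ n)
    (hmj : m < j) : ι (posB pc β j) ∉ DCTQ.ball (zdGraph (k + t)) (0 : Site (k + t)) m := by
  intro hmem
  have h1 := norm_le_of_mem_ball m _ hmem
  have h2 : (j : ℤ) ≤ ∑ i, |ι (posB pc β j) i| := by
    rw [Fin.sum_univ_add]
    have ht : ∑ a : Fin k, |ι (posB pc β j) (Fin.castAdd t a)| ≥ (j : ℤ) := by
      have hs := sum_posB_fst pc β hjn
      rw [← hs]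
      exact sum_le_sum fun a _ => by simpa [ι, Fin.append_left] using le_abs_self ((posB pc β j).1 a)
    have hx : 0 ≤ ∑ l : Fin t, |ι (posB pc β j) (Fin.natAdd k l)| := sum_nonneg fun _ _ => abs_nonneg _
    linarith
  have h3 : (m : ℤ) < j := by exact_mod_cast hmj
  linarith

/-- The origin is a vertex of every block word with at least one block. -/
theorem zero_mem_VglobS (pc : Fin np → List (Fin t × Bool)) {n : ℕ} (β : Fin (n + 1) → Blk np k) :
    (0 : Off t k) ∈ VglobS pc β := by
  have h := posB_mem_VjS pc β ⟨0, Nat.succ_pos n⟩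
  have h0 : posB pc β ((⟨0, Nat.succ_pos n⟩ : Fin (n + 1)) : ℕ) = 0 := by simp [posB]
  rw [h0] at h
  exact mem_biUnion.2 ⟨⟨0, Nat.succ_pos n⟩, mem_univ _, h⟩

/-- **An open block word of `m + 2` blocks realises the site exit event of the ball `B(0, m)`**: the open-site graph
joins the origin to the start of block `m + 1`, which lies outside the ball, so the path leaves the ball through its
inner vertex boundary. -/
theorem exitEvent_of_openV (pc : Fin np → List (Fin t × Bool)) {m : ℕ} (β : Fin (m + 2) → Blk np k)
    {ω : SiteConfig (Site (k + t))} (hω : ∀ g ∈ VglobS pc β, ι g ∈ ω) :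
    ω ∈ exitEvent (zdGraph (k + t)) (DCTQ.ball (zdGraph (k + t)) (0 : Site (k + t)) m) (0 : Site (k + t)) := by
  set Λ := DCTQ.ball (zdGraph (k + t)) (0 : Site (k + t)) m with hΛ
  obtain ⟨w⟩ := reachable_blocks pc β hω (m + 1) (by omega)
  have h0 : (0 : Site (k + t)) ∈ Λ := DCTQ.mem_ball_self _ _
  have hout : ι (posB pc β (m + 1)) ∉ Λ := posB_not_mem_ball' pc β (by omega) (Nat.lt_succ_self m)
  obtain ⟨b, hb, h0Λ, hbΛ, hr⟩ := exists_innerBoundary_reachable_of_walk (siteOpenGraph_le _ ω) Λ w h0 hout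
  have h0open : (0 : Site (k + t)) ∈ ω := by
    have := hω _ (zero_mem_VglobS pc β)
    rwa [ι_zero] at this
  have hbopen : b ∈ ω :=
    mem_of_siteOpenGraph_reachable (hr.map (SimpleGraph.Embedding.induce (↑Λ : Set (Site (k + t)))).toHom) h0open
  rw [mem_exitEvent_iff]
  exact ⟨b, hb, h0open, hbopen, h0Λ, hbΛ, hr⟩

end Summit.CriticalPhenomena.PercolationContinuityZ3.Theorems.Pcint.BSMX

end
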